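import Summits.HodgeConjecture.CorCM.MultiFieldWeilDihedralImage
import Summits.HodgeConjecture.CorCM.MultiFieldWeilUnitsSeparated
import Summits.HodgeConjecture.CorCM.MultiFieldWeilGaloisHypotheses
import HarnessLib

/-!
# MULTI-FIELD WEIL ENGINE — THE DIHEDRAL UNIT, REALISED: a CM field `K ∋ k` with five `τ`-embeddings whose Galois closure has degree `≤ 10·[k : ℚ]` and one `τ`-embedding
# with a value outside the image of another has a DIHEDRAL image; two `2`-member types with no common non-trivial symmetry separate (realised level)

Cell `pub-hodgecm2` (COR-CM), seat b30 gen 42 (2026-08-26); count-neutral own lane MULTI-FIELD WEIL ENGINE (stem `MultiFieldWeil*`), realised level, the sequel of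
`CorCM/MultiFieldWeilDihedralImage.lean` (census: a transitive closed set of at most ten permutations of five letters with a non-identity element fixing a letter is `g D₅ g⁻¹`;
the separation property of a unit of two `2`-sets free of common symmetries) in the engine's setting (`k = Kf i₀` with its embedding `τ`, slots `K_m = Kf (is m)`, frames `e m`
reading the sign over `τ`, realised tuples `realisedTuples e τ`).  Theorems only; no definition, no named fact, no `sorry`.  HONEST FRAMING: Galois theory of number fields inside
`ℂ`; `HC_CM` is NOT touched.

* §1 **`card_image_realisedTuples_mul_le`**: the permutations of the `τ`-embeddings of `K_{m₀}` induced by the realised tuples number at most `[L(K_{m₀}) : ℚ] / [k : ℚ]`,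
  `L(K) = normalClosure ℚ K ℂ`: two automorphisms of `ℂ` over `τ(k)` inducing different permutations restrict to different `τ(k)`-embeddings of the compositum
  `τ(k)(s_a(K_{m₀}) : a) ⊆ L(K_{m₀})`, and these number `[compositum : τ(k)]` (Mathlib `AlgHom.card`).
* §2 **`exists_fix_ne_one_realisedTuples`**: if a `τ`-embedding `t₀` takes a value outside `ℚ(s₀(K_{m₀}))` for another `τ`-embedding `s₀`, some realised tuple fixes the letter of
  `s₀` and is not the identity at `m₀` (`exists_ringEquiv_fix_comp_ne_of_apply_not_mem`).
* §3 **`const_of_signed_realisedTuples_of_dihedral`** — THE SEPARATION PROPERTY OF A DIHEDRAL DECIC UNIT: `[K_{m₀} : k] = 5` letters, `[k : ℚ] = 2`, `[L(K_{m₀}) : ℚ] ≤ 20`,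
  the hypothesis of §2, at most two position sets of size `2` on the letters of `m₀` stabilised together by no realised tuple other than the identity at `m₀` (`hfree`) ⟹ every
  family of integer defects whose total signed sum over the realised tuples is constant is constant — the hypothesis `hunit` of
  `hodgeConjectureFor_biproduct_comp_of_unitsSeparated_frames` for a unit over a DIHEDRAL decic CM field (`K = k·K⁺`, `K⁺` a real quintic field with Galois group `D₅`),
  via `const_of_signed_of_equiv` (`Fin (n m₀) ≃ Fin 5`) and `const_of_signed_of_dihedral_image`.
[cite: Lang2002, V §2 Thm. 2.8; VI §1 Thm. 1.1, Cor. 1.6; I §6] [cite: Shimura1998, §18.2 Lemma (i)] [cite: DixonMortimer1996, §1.6, Thm. 1.6A; §2.1; §3.3] [cite: Serre1977, §5.3]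

## References
* [Lang2002] S. Lang, *Algebra*, GTM 211, I §6, V §2 (Thm. 2.8), VI §1 (Thm. 1.1, Cor. 1.6).  [Shimura1998] G. Shimura, *Abelian varieties with complex multiplication and modular
  functions*, §18.2 Lemma (i).  [DixonMortimer1996] J. D. Dixon, B. Mortimer, *Permutation Groups*, GTM 163, §1.6, §2.1, §3.3.  [Serre1977] J.-P. Serre, *Linear Representations
  of Finite Groups*, GTM 42, §5.3.
-/

noncomputable section

open IntermediateField NumberField

namespace Summit.HodgeConjecture.CorCM.MultiFieldWeil

open Finset

open scoped Classical

section Realised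

variable {I : Type} {r : ℕ} {Kf : I → Type} [∀ i, Field (Kf i)] [∀ i, NumberField (Kf i)] {i₀ : I} {is : Fin r → I} {n : Fin r → ℕ}
  {e : ∀ m : Fin r, (Kf (is m) →+* ℂ) ≃ Fin (n m) × Bool} {τ : Kf i₀ →+* ℂ} {im : ∀ m : Fin r, Kf i₀ →+* Kf (is m)}
  (he_sign : ∀ (m : Fin r) (s : Kf (is m) →+* ℂ), (e m s).2 = true ↔ s.comp (im m) = τ)

/-! ## §1 The image at one slot is bounded by the degree of the Galois closure -/

include he_sign in
/-- **THE PERMUTATIONS OF THE `τ`-EMBEDDINGS OF `K_{m₀}` INDUCED BY THE REALISED TUPLES NUMBER AT MOST `[L(K_{m₀}) : ℚ] / [k : ℚ]`** (stated multiplied out):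
an automorphism of `ℂ` over `τ(k)` inducing the permutation `σ` restricts to a `τ(k)`-embedding of the compositum `F = τ(k)(s_a(K_{m₀}) : a)` of the `τ`-embeddings' images,
different permutations giving different embeddings; `F ⊆ L(K_{m₀})`, and the `τ(k)`-embeddings of `F` number `[F : τ(k)]` (Mathlib `AlgHom.card`).
[cite: Lang2002, V §2 Thm. 2.8; VI §1 Thm. 1.1, Cor. 1.6] [cite: Shimura1998, §18.2 Lemma (i)] -/
theorem card_image_realisedTuples_mul_le (m₀ : Fin r) (hn : 0 < n m₀) :
    ((realisedTuples e τ).image fun π => π m₀).card * Module.finrank ℚ (Kf i₀) ≤ Module.finrank ℚ ↥(normalClosure ℚ (Kf (is m₀)) ℂ) := by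
  set H₀ : Finset (Equiv.Perm (Fin (n m₀))) := (realisedTuples e τ).image fun π => π m₀ with hH₀
  set M : IntermediateField ℚ ℂ := adjoin ℚ (Set.range τ) with hM
  set N : IntermediateField ℚ ℂ := normalClosure ℚ (Kf (is m₀)) ℂ with hN
  have hMdeg : Module.finrank ℚ M = Module.finrank ℚ (Kf i₀) := finrank_adjoin_range_ringHom τ
  haveI : FiniteDimensional ℚ M := Module.finite_of_finrank_pos (by rw [hMdeg]; exact Module.finrank_pos)
  -- the `τ`-embeddings and their compositum over `M`
  let s : Fin (n m₀) → (Kf (is m₀) →+* ℂ) := fun a => (e m₀).symm (a, true)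
  have hs : ∀ a, (s a).comp (im m₀) = τ := fun a => (he_sign m₀ (s a)).1 (by simp [s])
  set S : Set ℂ := ⋃ a, Set.range (s a) with hS
  have hMN : M ≤ N := by
    rw [hM, adjoin_le_iff]
    rintro _ ⟨y, rfl⟩
    have : τ y = s ⟨0, hn⟩ (im m₀ y) := by rw [← RingHom.comp_apply, hs]
    rw [this]
    exact ringHom_apply_mem_normalClosure (s ⟨0, hn⟩) _
  have hSN : adjoin ℚ S ≤ N := by
    rw [adjoin_le_iff]
    intro x hx
    obtain ⟨a, hx⟩ := Set.mem_iUnion.1 hx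
    obtain ⟨y, rfl⟩ := hx
    exact ringHom_apply_mem_normalClosure (s a) y
  have hres : (adjoin M S).restrictScalars ℚ = M ⊔ adjoin ℚ S := restrictScalars_adjoin_eq_sup ℚ M S
  have hFN : (adjoin M S).restrictScalars ℚ ≤ N := by rw [hres]; exact sup_le hMN hSN
  haveI hfinQ : FiniteDimensional ℚ ↥((adjoin M S).restrictScalars ℚ) :=
    Module.Finite.of_injective (IntermediateField.inclusion hFN).toLinearMap (IntermediateField.inclusion_injective hFN)
  haveI : FiniteDimensional ℚ ↥(adjoin M S) := hfinQ
  haveI : FiniteDimensional M ↥(adjoin M S) := Module.Finite.of_restrictScalars_finite ℚ M _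
  have hdegQ : Module.finrank ℚ ↥(adjoin M S) ≤ Module.finrank ℚ N := IntermediateField.finrank_le_of_le_right hFN
  have htower : Module.finrank ℚ M * Module.finrank M ↥(adjoin M S) = Module.finrank ℚ ↥(adjoin M S) := Module.finrank_mul_finrank ℚ M ↥(adjoin M S)
  -- the generators lie in `F`
  have hmemF : ∀ a (y : Kf (is m₀)), s a y ∈ adjoin M S := fun a y => subset_adjoin M S (Set.mem_iUnion.2 ⟨a, y, rfl⟩)
  -- automorphisms realising the elements of `H₀`
  have hch : ∀ σ : ↥H₀, ∃ ρ : ℂ ≃+* ℂ, (ρ : ℂ →+* ℂ).comp τ = τ ∧ ∀ a, (ρ : ℂ →+* ℂ).comp (s a) = s (σ.1 a) := by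
    rintro ⟨σ, hσ⟩
    obtain ⟨π, hπ, rfl⟩ := Finset.mem_image.1 hσ
    obtain ⟨ρ, hρτ, hρ⟩ := (mem_realisedTuples e τ π).1 hπ
    exact ⟨ρ, hρτ, fun a => hρ m₀ a⟩
  choose ρ hρτ hρs using hch
  have hρM : ∀ (σ : ↥H₀) (x : ℂ), x ∈ M → ρ σ x = x := by
    intro σ x hx
    rw [hM, adjoin_range_ringHom_eq_fieldRange] at hx
    obtain ⟨y, rfl⟩ := AlgHom.mem_fieldRange.1 hx
    exact RingHom.congr_fun (hρτ σ) y
  -- the restriction map to `M`-embeddings of `F`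
  let Φ : ↥H₀ → (↥(adjoin M S) →ₐ[M] ℂ) := fun σ =>
    { ((ρ σ : ℂ →+* ℂ).comp (algebraMap ↥(adjoin M S) ℂ)) with
      commutes' := fun m => hρM σ (m : ℂ) m.2 }
  have hΦapp : ∀ (σ : ↥H₀) (x : ↥(adjoin M S)), Φ σ x = ρ σ (x : ℂ) := fun σ x => rfl
  have hΦ : Function.Injective Φ := by
    intro σ σ' hΦeq
    apply Subtype.ext
    refine Equiv.ext fun a => ?_
    have key : (ρ σ : ℂ →+* ℂ).comp (s a) = (ρ σ' : ℂ →+* ℂ).comp (s a) := by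
      ext y
      have := DFunLike.congr_fun hΦeq ⟨s a y, hmemF a y⟩
      rw [hΦapp, hΦapp] at this
      exact this
    rw [hρs σ a, hρs σ' a] at key
    have := (e m₀).symm.injective key
    exact congrArg Prod.fst this
  have h1 : H₀.card ≤ Module.finrank M ↥(adjoin M S) := by
    rw [← Fintype.card_coe H₀, ← AlgHom.card M ↥(adjoin M S) ℂ]
    exact Fintype.card_le_of_injective Φ hΦ
  calc H₀.card * Module.finrank ℚ (Kf i₀) = Module.finrank ℚ M * H₀.card := by rw [hMdeg, mul_comm]
    _ ≤ Module.finrank ℚ M * Module.finrank M ↥(adjoin M S) := Nat.mul_le_mul_left _ h1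
    _ = Module.finrank ℚ ↥(adjoin M S) := htower
    _ ≤ Module.finrank ℚ N := hdegQ

/-! ## §2 A realised tuple fixing one letter and moving another -/

include he_sign in
/-- **A NON-IDENTITY REALISED PERMUTATION WITH A FIXED LETTER** from a `τ`-embedding `t₀` of `K_{m₀}` with a value outside `ℚ(s₀(K_{m₀}))`, `s₀` another `τ`-embedding: an
automorphism of `ℂ` fixing `ℚ(s₀(K_{m₀})) ⊇ τ(k)` pointwise and moving `t₀` realises a tuple fixing the letter of `s₀` and moving the letter of `t₀`.
[cite: Lang2002, VI §1 Thm. 1.1, Cor. 1.6; V §2 Thm. 2.8] [cite: Shimura1998, §18.2 Lemma (i)] -/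
theorem exists_fix_ne_one_realisedTuples (m₀ : Fin r) {s₀ t₀ : Kf (is m₀) →+* ℂ} (hs₀ : s₀.comp (im m₀) = τ) (ht₀ : t₀.comp (im m₀) = τ)
    {x : Kf (is m₀)} (hx : t₀ x ∉ adjoin ℚ (Set.range s₀)) :
    ∃ π ∈ realisedTuples e τ, π m₀ ≠ 1 ∧ π m₀ (e m₀ s₀).1 = (e m₀ s₀).1 := by
  haveI : FiniteDimensional ℚ ↥(adjoin ℚ (Set.range s₀)) :=
    Module.finite_of_finrank_pos (by rw [finrank_adjoin_range_ringHom]; exact Module.finrank_pos)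
  obtain ⟨ρ, hρfix, hρt⟩ := exists_ringEquiv_fix_comp_ne_of_apply_not_mem (adjoin ℚ (Set.range s₀)) t₀ hx
  have hρs : (ρ : ℂ →+* ℂ).comp s₀ = s₀ := RingHom.ext fun y => hρfix _ (subset_adjoin ℚ _ ⟨y, rfl⟩)
  have hρτ : (ρ : ℂ →+* ℂ).comp τ = τ := by rw [← hs₀, ← RingHom.comp_assoc, hρs]
  obtain ⟨π, hπ, hπe⟩ := exists_mem_realisedTuples_of_comp_tau_eq he_sign ρ hρτ
  have hes₀ : (e m₀).symm ((e m₀ s₀).1, true) = s₀ := by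
    have h2 : (e m₀ s₀).2 = true := (he_sign m₀ s₀).2 hs₀
    rw [← h2, Prod.mk.eta, Equiv.symm_apply_apply]
  have het₀ : (e m₀).symm ((e m₀ t₀).1, true) = t₀ := by
    have h2 : (e m₀ t₀).2 = true := (he_sign m₀ t₀).2 ht₀
    rw [← h2, Prod.mk.eta, Equiv.symm_apply_apply]
  refine ⟨π, hπ, fun h1 => hρt ?_, ?_⟩
  · have := hπe m₀ (e m₀ t₀).1
    rw [het₀, h1, Equiv.Perm.one_apply, het₀] at this
    exact this
  · have := hπe m₀ (e m₀ s₀).1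
    rw [hes₀, hρs] at this
    have := (e m₀).symm.injective (this.symm.trans hes₀.symm)
    exact congrArg Prod.fst this

/-! ## §3 The separation property of a dihedral decic unit -/

include he_sign in
/-- **THE SEPARATION PROPERTY OF A DIHEDRAL DECIC UNIT (realised).**  `K_{m₀}` with five `τ`-embeddings, `[k : ℚ] = 2`, Galois closure `L(K_{m₀})` of degree `≤ 20`, a
`τ`-embedding with a value outside the image of another; at most two position sets of size `2` on the letters of `m₀` that no realised tuple other than the identity at `m₀`
stabilises together.  Then every family of integer defects whose total signed sum over the realised tuples is constant is constant: the image at `m₀` is a transitive closed set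
of at most `10` permutations (§1) with a non-identity element fixing a letter (§2), hence dihedral, and `const_of_signed_of_dihedral_image` applies after relabelling the letters
by `Fin (n m₀) ≃ Fin 5`. [cite: DixonMortimer1996, §1.6, Thm. 1.6A; §3.3] [cite: Serre1977, §5.3] [cite: Lang2002, VI §1 Thm. 1.1; I §6] [cite: Shimura1998, §18.2 Lemma (i)] -/
theorem const_of_signed_realisedTuples_of_dihedral (m₀ : Fin r) (h5 : n m₀ = 5) (h2 : Module.finrank ℚ (Kf i₀) = 2)
    (h20 : Module.finrank ℚ ↥(normalClosure ℚ (Kf (is m₀)) ℂ) ≤ 20)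
    (hns : ∃ s₀ t₀ : Kf (is m₀) →+* ℂ, s₀.comp (im m₀) = τ ∧ t₀.comp (im m₀) = τ ∧ ∃ x, t₀ x ∉ adjoin ℚ (Set.range s₀))
    {ι : Type} [Fintype ι] (hι : Fintype.card ι ≤ 2) (Q : ι → Finset (Fin (n m₀))) (hQ : ∀ i, (Q i).card = 2)
    (hfree : ∀ π ∈ realisedTuples e τ, (∀ (i : ι) (x : Fin (n m₀)), π m₀ x ∈ Q i ↔ x ∈ Q i) → π m₀ = 1)
    (u : ι → Fin (n m₀) → ℤ) {w : ℤ} (h : ∀ π ∈ realisedTuples e τ, (∑ i, ∑ x : Fin (n m₀), (if π m₀ x ∈ Q i then u i x else -u i x)) = w)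
    (i : ι) (a b : Fin (n m₀)) : u i a = u i b := by
  set R := realisedTuples e τ with hR
  have hmul : ∀ π ∈ R, ∀ π' ∈ R, π * π' ∈ R := fun _ hπ _ hπ' => mul_mem_realisedTuples e τ hπ hπ'
  have hinv : ∀ π ∈ R, π⁻¹ ∈ R := fun _ hπ => inv_mem_realisedTuples hπ
  have hne : R.Nonempty := realisedTuples_nonempty (e := e) he_sign
  set H₀ : Finset (Equiv.Perm (Fin (n m₀))) := R.image fun π => π m₀ with hH₀
  have hmem₀ : ∀ σ, σ ∈ H₀ ↔ ∃ π ∈ R, π m₀ = σ := fun σ => Finset.mem_image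
  -- relabel the letters by `Fin 5`
  set f : Fin (n m₀) ≃ Fin 5 := finCongr h5 with hf
  have h' : ∀ σ ∈ H₀, (∑ i, ∑ x : Fin (n m₀), (if σ x ∈ Q i then u i x else -u i x)) = w := by
    intro σ hσ
    obtain ⟨π, hπ, rfl⟩ := (hmem₀ σ).1 hσ
    exact h π hπ
  refine const_of_signed_of_equiv f H₀ Q (fun u' w' hu' => ?_) u h' i a b
  -- the transported image `H ⊆ Sym(5)`
  set cj : Equiv.Perm (Fin (n m₀)) → Equiv.Perm (Fin 5) := fun σ => (f.symm.trans σ).trans f with hcj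
  have hcj_apply : ∀ σ y, cj σ y = f (σ (f.symm y)) := fun σ y => rfl
  have hcj_mul : ∀ σ σ', cj (σ * σ') = cj σ * cj σ' := fun σ σ' => Equiv.ext fun y => by
    simp only [hcj_apply, Equiv.Perm.mul_apply, Equiv.symm_apply_apply]
  have hcj_one : cj 1 = 1 := Equiv.ext fun y => by simp only [hcj_apply, Equiv.Perm.one_apply, Equiv.apply_symm_apply]
  have hcj_inv : ∀ σ, cj σ⁻¹ = (cj σ)⁻¹ := fun σ => by
    rw [eq_inv_iff_mul_eq_one, ← hcj_mul, inv_mul_cancel, hcj_one]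
  have hcj_inj : Function.Injective cj := by
    intro σ σ' hσσ
    refine Equiv.ext fun x => ?_
    have := congrArg (fun π : Equiv.Perm (Fin 5) => π (f x)) hσσ
    simp only [hcj_apply, Equiv.symm_apply_apply] at this
    exact f.injective this
  set H : Finset (Equiv.Perm (Fin 5)) := H₀.image cj with hH
  have hmemH : ∀ σ₅, σ₅ ∈ H ↔ ∃ π ∈ R, cj (π m₀) = σ₅ := fun σ₅ => by
    rw [hH, Finset.mem_image]
    constructor
    · rintro ⟨σ, hσ, rfl⟩
      obtain ⟨π, hπ, rfl⟩ := (hmem₀ σ).1 hσ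
      exact ⟨π, hπ, rfl⟩
    · rintro ⟨π, hπ, rfl⟩
      exact ⟨π m₀, (hmem₀ _).2 ⟨π, hπ, rfl⟩, rfl⟩
  have hmulH : ∀ σ ∈ H, ∀ σ' ∈ H, σ * σ' ∈ H := by
    intro σ hσ σ' hσ'
    obtain ⟨π, hπ, rfl⟩ := (hmemH σ).1 hσ
    obtain ⟨π', hπ', rfl⟩ := (hmemH σ').1 hσ'
    exact (hmemH _).2 ⟨π * π', hmul _ hπ _ hπ', by rw [Pi.mul_apply, hcj_mul]⟩
  have hinvH : ∀ σ ∈ H, σ⁻¹ ∈ H := by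
    intro σ hσ
    obtain ⟨π, hπ, rfl⟩ := (hmemH σ).1 hσ
    exact (hmemH _).2 ⟨π⁻¹, hinv _ hπ, by rw [Pi.inv_apply, hcj_inv]⟩
  have hneH : H.Nonempty := by
    obtain ⟨π, hπ⟩ := hne
    exact ⟨cj (π m₀), (hmemH _).2 ⟨π, hπ, rfl⟩⟩
  -- at most ten elements
  have hcardH : H.card ≤ 10 := by
    have h1 : H.card ≤ H₀.card := Finset.card_image_le
    have hb : H₀.card * Module.finrank ℚ (Kf i₀) ≤ Module.finrank ℚ ↥(normalClosure ℚ (Kf (is m₀)) ℂ) :=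
      card_image_realisedTuples_mul_le (e := e) he_sign m₀ (by rw [h5]; norm_num)
    rw [h2] at hb
    omega
  -- transitive
  have htransH : ∀ a b : Fin 5, ∃ σ ∈ H, σ a = b := by
    intro a b
    obtain ⟨π, hπ, hab⟩ := transitive_realisedTuples (e := e) he_sign m₀ (f.symm a) (f.symm b)
    exact ⟨cj (π m₀), (hmemH _).2 ⟨π, hπ, rfl⟩, by rw [hcj_apply, hab, Equiv.apply_symm_apply]⟩
  -- a non-identity element with a fixed letter
  have hfixH : ∃ σ ∈ H, σ ≠ 1 ∧ ∃ a, σ a = a := by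
    obtain ⟨s₀, t₀, hs₀, ht₀, x, hx⟩ := hns
    obtain ⟨π, hπ, hπ1, hπa⟩ := exists_fix_ne_one_realisedTuples (e := e) he_sign m₀ hs₀ ht₀ hx
    refine ⟨cj (π m₀), (hmemH _).2 ⟨π, hπ, rfl⟩, fun h1 => hπ1 (hcj_inj (h1.trans hcj_one.symm)), f (e m₀ s₀).1, ?_⟩
    rw [hcj_apply, Equiv.symm_apply_apply, hπa]
  -- the transported sets
  have hQ5 : ∀ i, ((Q i).image ⇑f).card = 2 := fun i => by rw [Finset.card_image_of_injective _ f.injective, hQ i]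
  have hmemQ5 : ∀ (i : ι) (x : Fin (n m₀)), f x ∈ (Q i).image ⇑f ↔ x ∈ Q i := fun i x => by
    rw [Finset.mem_image]
    constructor
    · rintro ⟨y, hy, hxy⟩; rwa [← f.injective hxy]
    · intro hx; exact ⟨x, hx, rfl⟩
  have hfreeH : ∀ σ ∈ H, (∀ (i : ι) (y : Fin 5), σ y ∈ (Q i).image ⇑f ↔ y ∈ (Q i).image ⇑f) → σ = 1 := by
    intro σ hσ hstab
    obtain ⟨π, hπ, rfl⟩ := (hmemH σ).1 hσ
    have hπ1 : π m₀ = 1 := hfree π hπ fun i x => by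
      have := hstab i (f x)
      rwa [hcj_apply, Equiv.symm_apply_apply, hmemQ5, hmemQ5] at this
    rw [hπ1, hcj_one]
  have hu'' : ∀ σ ∈ H, (∑ i, ∑ y : Fin 5, (if σ y ∈ (Q i).image ⇑f then u' i y else -u' i y)) = w' := by
    intro σ hσ
    rw [hH] at hσ
    obtain ⟨σ₀, hσ₀, rfl⟩ := Finset.mem_image.1 hσ
    exact hu' σ₀ hσ₀
  exact const_of_signed_of_dihedral_image hmulH hinvH hneH hcardH htransH hfixH hι (fun i => (Q i).image ⇑f) hQ5 hfreeH u' hu''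

end Realised

end Summit.HodgeConjecture.CorCM.MultiFieldWeil

end
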